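import Summits.CriticalPhenomena.PercolationContinuityZ3.Theorems.FK.InfiniteVolumeDLRLocality
import HarnessLib

/-!
# FK-continuity transplant, FO-06 (construction half): the bad events `D_m(Λ)` of Lemma (4.39) are local and
# `P(D_m(Λ)) → 0` for every box limit (`p < 1`)

Cell `fk-continuity` (bschramm), row FO-06b-6; support file for the FK-continuity transplant
(`--supports stmt-CriticalPhenomena-4575`); builds on p205010 (kernel theorem, internal audit signed;
external expert review pending). No named facts, no sorries, standard axioms. General dimension `d`.

* `isLocalEvent_regionBadEvent`, `measurableSet_regionBadEvent` — `D_m(Λ) = regionBadEvent Λ m` is a local event;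
* `iInter_iUnion_regionBadEvent_subset` — `limsup_m D_m(Λ) ⊆ {ω ∖ E_Λ has two infinite clusters}` (Grimmett's
  "`⋂_Δ D_{Λ,Δ} = {I_Λ ≥ 2}`", pigeonhole over the finitely many pairs of vertices of `Λ`);
* `IsBoxLimit.real_preimage_sdiff_not_numInfiniteClusters_le_one` — closing the finitely many edges of `E_Λ`
  costs at most `(1-p)^{-|E_Λ|}` (deletion tolerance, 06b `IsBoxLimit.pow_mul_real_preimage_sdiff_le`), so under
  a.s. uniqueness that event is null (Grimmett's (4.42));
* **`IsBoxLimit.tendsto_real_regionBadEvent`** — `P(D_m(Λ)) → 0` for every box limit, `0 ≤ p < 1`, `q ≥ 1`, the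
  uniqueness being FO-08h's `IsBoxLimit.ae_numInfiniteClusters_le_one'`; `tendsto_rcLimit_real_regionBadEvent`;
* `mem_iff_sdiff_mem_of_determinedBy`, `mem_regionBadEvent_iff_sdiff_mem`, `mem_cylEvent_iff_sdiff_mem` — events
  determined off `E_Λ` (in particular `D_m(Λ)`) do not see the configuration on `E_Λ`.

## References

* G. Grimmett, *The Random-Cluster Model*, Springer 2006: Lemma (4.39) eqs. (4.40)–(4.42), proof of
  Thm. (4.31), last display p. 86. [Grimmett2006]
-/

noncomputable section

open MeasureTheory Set Filter
open scoped Topology ENNReal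

namespace Summit.CriticalPhenomena.PercolationContinuityZ3.Theorems.FK

open Literature.Probability.Percolation Literature.Probability.LatticeModels

variable {d : ℕ}

/-! ### The bad events are local and have vanishing probability -/

section BadEvent

variable {b : Bool} {p q : ℝ} {P : Measure (BondConfig (Site d))}

/-- A finite union of local events is local. [folklore] -/
theorem isLocalEvent_biUnion_finset {ι κ : Type*} [DecidableEq ι] (s : Finset κ) {A : κ → Set (Set ι)}
    (hA : ∀ k ∈ s, IsLocalEvent (A k)) : IsLocalEvent (⋃ k ∈ s, A k) := by
  classical
  induction s using Finset.induction_on with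
  | empty => simpa using (isLocalEvent_empty (ι := ι))
  | @insert k s hk ih =>
    rw [Finset.set_biUnion_insert]
    exact (hA k (Finset.mem_insert_self k s)).union (ih fun k' hk' => hA k' (Finset.mem_insert_of_mem hk'))

/-- **`D_m(Λ)` is a local event.** [cite: Grimmett2006, Lemma (4.39) eq. (4.40)] -/
theorem isLocalEvent_regionBadEvent (Λ : Finset (Site d)) (m : ℕ) : IsLocalEvent (regionBadEvent Λ m) := by
  classical
  rw [regionBadEvent]
  refine isLocalEvent_biUnion_finset Λ fun u _ => isLocalEvent_biUnion_finset Λ fun v _ => ?_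
  exact isLocalEvent_preimage_sdiff
    (((isLocalEvent_exit m u).inter (isLocalEvent_exit m v)).inter
      (isLocalEvent_openConnVia_withinGraph_box m u v).compl) _

/-- `D_m(Λ)` is measurable. [folklore] -/
theorem measurableSet_regionBadEvent (Λ : Finset (Site d)) (m : ℕ) : MeasurableSet (regionBadEvent Λ m) :=
  measurableSet_of_isLocalEvent_holds (isLocalEvent_regionBadEvent Λ m)

/-- **`limsup_m D_m(Λ) ⊆ {ω ∖ E_Λ has two infinite clusters}`** (Grimmett 2006, "⋂_Δ D_{Λ,Δ} = {I_Λ ≥ 2}" with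
(4.42), region version): if for arbitrarily large `m` some two vertices of `Λ` exit `Λ_m` off `E_Λ` without
being joined inside `Λ_m`, then (pigeonhole over the finitely many pairs) some fixed pair does so, and their
clusters in `ω ∖ E_Λ` are infinite and distinct. [cite: Grimmett2006, Lemma (4.39) eqs. (4.40)–(4.42)] -/
theorem iInter_iUnion_regionBadEvent_subset (Λ : Finset (Site d)) :
    (⋂ N : ℕ, ⋃ m : ℕ, ⋃ (_ : N ≤ m), regionBadEvent Λ m) ⊆
      (fun ω : BondConfig (Site d) => ω \ ↑(edgesIn (zdGraph d) Λ)) ⁻¹' {ω | ¬ numInfiniteClusters ω ≤ 1} := by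
  classical
  intro ω hω
  simp only [Set.mem_iInter, Set.mem_iUnion, exists_prop] at hω
  set ζ := ω \ ↑(edgesIn (zdGraph d) Λ) with hζ
  intro hN1
  -- the bad property of a pair, at scale `m`
  set bad : ℕ → Site d × Site d → Prop := fun m uv =>
    ζ ∈ exitsBox d m uv.1 ∧ ζ ∈ exitsBox d m uv.2 ∧
      ζ ∉ openConnVia (withinGraph ⊤ (↑(box d m) : Set (Site d))) uv.1 uv.2 with hbad
  -- no pair is bad frequently
  have hev : ∀ uv ∈ Λ ×ˢ Λ, ∀ᶠ m in atTop, ¬ bad m uv := by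
    intro uv _
    by_contra hfr
    rw [Filter.not_eventually] at hfr
    simp only [not_not] at hfr
    rw [Filter.frequently_atTop] at hfr
    have hx : ζ ∈ percolatesAt uv.1 :=
      mem_percolatesAt_of_frequently_exit fun N => by
        obtain ⟨m, hNm, h1, -, -⟩ := hfr N
        exact ⟨m, hNm, h1⟩
    have hy : ζ ∈ percolatesAt uv.2 :=
      mem_percolatesAt_of_frequently_exit fun N => by
        obtain ⟨m, hNm, -, h2, -⟩ := hfr N
        exact ⟨m, hNm, h2⟩
    have hxy : ζ ∉ openConn uv.1 uv.2 :=
      not_mem_openConn_of_frequently fun N => by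
        obtain ⟨m, hNm, -, -, h3⟩ := hfr N
        exact ⟨m, hNm, h3⟩
    exact hxy (mem_openConn_of_numInfiniteClusters_le_one hN1 hx hy)
  -- hence eventually no pair is bad, contradicting `hω`
  have hall : ∀ᶠ m in atTop, ∀ uv ∈ Λ ×ˢ Λ, ¬ bad m uv := (Finset.eventually_all (Λ ×ˢ Λ)).2 hev
  obtain ⟨N, hN⟩ := Filter.eventually_atTop.1 hall
  obtain ⟨m, hNm, hm⟩ := hω N
  obtain ⟨u, hu, v, hv, h1, h2, h3⟩ := mem_regionBadEvent_iff.1 hm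
  exact hN m hNm (u, v) (Finset.mk_mem_product hu hv) ⟨h1, h2, h3⟩

/-- **Deletion tolerance + uniqueness kill the bad event** (region version of 06b-g2's one-edge lemma): for a
box limit with `p < 1`, `q ≥ 1` and a.s. at most one infinite cluster, `P{ω | ω ∖ E_Λ has ≥ 2 infinite
clusters} = 0` (closing the finitely many edges of `E_Λ` costs at most the factor `(1-p)^{-|E_Λ|}`,
Grimmett's (4.42)). [cite: Grimmett2006, Lemma (4.39) eq. (4.42)] -/
theorem IsBoxLimit.real_preimage_sdiff_not_numInfiniteClusters_le_one (hP : IsBoxLimit d b p q P)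
    (hp : p ∈ Set.Ico (0 : ℝ) 1) (hq : 1 ≤ q) (huniq : ∀ᵐ ω ∂P, numInfiniteClusters ω ≤ 1)
    (F : Finset (Sym2 (Site d))) :
    P.real ((fun η : BondConfig (Site d) => η \ ↑F) ⁻¹' {ω | ¬ numInfiniteClusters ω ≤ 1}) = 0 := by
  classical
  haveI := hP.isProbabilityMeasure
  have h0 : P.real {ω : BondConfig (Site d) | ¬ numInfiniteClusters ω ≤ 1} = 0 := by
    rw [measureReal_def, ae_iff.1 huniq, ENNReal.toReal_zero]
  have h1 := hP.pow_mul_real_preimage_sdiff_le ⟨hp.1, hp.2.le⟩ hq F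
    (measurableSet_not_numInfiniteClusters_le_one (V := Site d))
  rw [h0] at h1
  have hpos : 0 < (1 - p) ^ F.card := pow_pos (sub_pos.2 hp.2) _
  have h2 : P.real ((fun η : BondConfig (Site d) => η \ ↑F) ⁻¹' {ω | ¬ numInfiniteClusters ω ≤ 1}) ≤ 0 :=
    le_of_mul_le_mul_left (by rw [mul_zero]; exact h1) hpos
  exact le_antisymm h2 measureReal_nonneg

/-- **`P(D_m(Λ)) → 0`** for every box limit with `0 ≤ p < 1`, `q ≥ 1` (`D_m ⊆ ⋃_{k ≥ m} D_k ↓ limsup D`, a null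
event by `iInter_iUnion_regionBadEvent_subset`, deletion tolerance and the a.s. uniqueness of the infinite
cluster `IsBoxLimit.ae_numInfiniteClusters_le_one'`). [cite: Grimmett2006, proof of Thm. (4.31), last display p. 86, with (4.42)] -/
theorem IsBoxLimit.tendsto_real_regionBadEvent (hP : IsBoxLimit d b p q P) (hp : p ∈ Set.Ico (0 : ℝ) 1)
    (hq : 1 ≤ q) (Λ : Finset (Site d)) :
    Tendsto (fun m : ℕ => P.real (regionBadEvent Λ m)) atTop (𝓝 0) := by
  classical
  haveI := hP.isProbabilityMeasure
  have huniq := hP.ae_numInfiniteClusters_le_one' ⟨hp.1, hp.2.le⟩ hq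
  set D : ℕ → Set (BondConfig (Site d)) := fun m => regionBadEvent Λ m with hD
  have hDm : ∀ m, MeasurableSet (D m) := fun m => measurableSet_regionBadEvent Λ m
  set V : ℕ → Set (BondConfig (Site d)) := fun N => ⋃ m, ⋃ (_ : N ≤ m), D m with hV
  have hVanti : Antitone V := by
    intro N N' hNN' ω hω
    simp only [hV, Set.mem_iUnion, exists_prop] at hω ⊢
    obtain ⟨m, hm, hωm⟩ := hω
    exact ⟨m, hNN'.trans hm, hωm⟩
  have hVm : ∀ N, MeasurableSet (V N) := fun N =>
    MeasurableSet.iUnion fun m => MeasurableSet.iUnion fun _ => hDm m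
  have hV0 : P.real (⋂ N, V N) = 0 := by
    refine le_antisymm ?_ measureReal_nonneg
    calc P.real (⋂ N, V N)
        ≤ P.real ((fun η : BondConfig (Site d) => η \ ↑(edgesIn (zdGraph d) Λ)) ⁻¹'
            {ω | ¬ numInfiniteClusters ω ≤ 1}) :=
          measureReal_mono (iInter_iUnion_regionBadEvent_subset Λ)
      _ = 0 := hP.real_preimage_sdiff_not_numInfiniteClusters_le_one hp hq huniq _
  have hVlim : Tendsto (fun N => P.real (V N)) atTop (𝓝 0) := by
    rw [← hV0]
    exact tendsto_measureReal_iInter_of_antitone P hVanti hVm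
  refine squeeze_zero (fun m => measureReal_nonneg) (fun m => ?_) hVlim
  exact measureReal_mono (fun ω hω => Set.mem_iUnion.2 ⟨m, Set.mem_iUnion.2 ⟨le_rfl, hω⟩⟩)
    (measure_ne_top P _)

/-- The same for THE limit `rcLimit d b p q`. [cite: Grimmett2006, proof of Thm. (4.31) p. 86] -/
theorem tendsto_rcLimit_real_regionBadEvent (b : Bool) (hp : p ∈ Set.Ico (0 : ℝ) 1) (hq : 1 ≤ q)
    (Λ : Finset (Site d)) :
    Tendsto (fun m : ℕ => (rcLimit d b p q).real (regionBadEvent Λ m)) atTop (𝓝 0) :=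
  (isBoxLimit_rcLimit b ⟨hp.1, hp.2.le⟩ hq).tendsto_real_regionBadEvent hp hq Λ

end BadEvent

/-! ### Events that do not see the configuration on `E_Λ` -/

section OffRegion

variable {Λ : Finset (Site d)}

/-- An event determined by a set of pairs disjoint from `E_Λ` does not see the configuration on `E_Λ`. [folklore] -/
theorem mem_iff_sdiff_mem_of_determinedBy {X : Set (BondConfig (Site d))} {T : Set (Sym2 (Site d))}
    (hX : DeterminedBy X T) (hT : Disjoint T ↑(edgesIn (zdGraph d) Λ)) (χ : BondConfig (Site d)) :
    χ ∈ X ↔ χ \ ↑(edgesIn (zdGraph d) Λ) ∈ X := by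
  refine (determinedBy_iff _ _).1 hX _ _ ?_
  ext e
  simp only [Set.mem_inter_iff, Set.mem_sdiff]
  constructor
  · rintro ⟨he, heT⟩
    exact ⟨⟨he, fun heU => Set.disjoint_left.1 hT heT heU⟩, heT⟩
  · rintro ⟨⟨he, -⟩, heT⟩
    exact ⟨he, heT⟩

/-- The bad event `D_m(Λ)` does not see the configuration on `E_Λ`. [cite: Grimmett2006, Lemma (4.39) eq. (4.40)] -/
theorem mem_regionBadEvent_iff_sdiff_mem (Λ : Finset (Site d)) (m : ℕ) (χ : BondConfig (Site d)) :
    χ ∈ regionBadEvent Λ m ↔ χ \ ↑(edgesIn (zdGraph d) Λ) ∈ regionBadEvent Λ m := by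
  rw [mem_regionBadEvent_iff, mem_regionBadEvent_iff, sdiff_sdiff, Set.union_self]

/-- A cylinder event over pairs off `E_Λ` does not see the configuration on `E_Λ`. [folklore] -/
theorem mem_cylEvent_iff_sdiff_mem {E' : Finset (Sym2 (Site d))} (hE' : Disjoint E' (edgesIn (zdGraph d) Λ))
    (ζ : Finset (Sym2 (Site d))) (χ : BondConfig (Site d)) :
    χ ∈ cylEvent E' ζ ↔ χ \ ↑(edgesIn (zdGraph d) Λ) ∈ cylEvent E' ζ := by
  simp only [mem_cylEvent_iff, Set.mem_sdiff, Finset.mem_coe]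
  refine forall₂_congr fun e he => ?_
  have heU : e ∉ edgesIn (zdGraph d) Λ := Finset.disjoint_left.1 hE' he
  tauto

end OffRegion

end Summit.CriticalPhenomena.PercolationContinuityZ3.Theorems.FK

end
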